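import Summits.Ventures.PackingBounds.Configurations.SixHundredCellCodeCounts
import Summits.Ventures.PackingBounds.Configurations.SubspaceTransfer
import Summits.Ventures.PackingBounds.Configurations.IcosahedronNbr

/-!
# `120`-point codes of angle `36°` in `ℝ⁴` contain a tetrahedral cell (four points pairwise at `36°`)

Framing: lottery ticket; floor = certified bounds/negative ranges. Venture `PackingBounds` (cell
`pub-packcert`, seat `pub-packcert-energy`) — uniqueness of the 600-cell, step 3 (after
`SixHundredCellCodeDesign`, `SixHundredCellCodeCounts`).

Let `C ⊂ S³` be a `120`-point code with pairwise inner products `≤ t = (1+√5)/4` and `x ∈ C`. The twelve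
neighbours `N(x)` of `x` at inner product `t` (`card_nbr_eq_twelve`) are pairwise at inner product `t`, `1/2` or
`(√5-1)/4` (`inner_nbr_nbr`: two points at `36°` from `x` are at most `72°` apart). Translating by `-t x` and
rescaling, `N(x)` becomes a `12`-point configuration of unit vectors in the `3`-space `x^⊥` with pairwise inner
products in `{-1, ±1/√5}`; moved into `ℝ³` by an inner-product preserving map (`Config.exists_inner_preserving`)
it satisfies the hypotheses of the tree's icosahedron analysis (`IcosahedronNbr.card_nbr`,
`IcosahedronNbr.card_filter_eq_two`): every vertex of this icosahedron has five neighbours and two of them are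
adjacent. Pulling back: there are `y, z, w ∈ N(x)` pairwise at inner product `t`, i.e. **`C` contains four points
pairwise at `36°`** (`exists_frame`) — a `t`-frame in the sense of `CliqueFrame`, hence a basis of `ℝ⁴`.

## References
* P. Boyvalenkov, D. Danev, *Uniqueness of the 120-point spherical 11-design in four dimensions*,
  Arch. Math. 77 (2001) 360–368.
* H. Cohn, A. Kumar, J. Amer. Math. Soc. 20 (2007) 99–148, Table 1. [`CohnKumar2006`]
-/

noncomputable section

namespace Summit.Ventures.PackingBounds.Config.SixHundredCellCode

open Finset Module Literature.Analysis.SpecialFunctions Literature.Geometry.DiscreteGeometry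

section config

variable {C : Finset (EuclideanSpace ℝ (Fin 4))} (h1 : ∀ x ∈ C, ‖x‖ = 1)
  (h2 : ∀ x ∈ C, ∀ y ∈ C, x ≠ y → inner ℝ x y ≤ (1 + Real.sqrt 5) / 4) (hN : C.card = 120)
include h1 h2 hN

/-- **Two neighbours at `36°` of a common point are at most `72°` apart**: their inner product is `t`, `1/2` or
`(√5-1)/4 = cos 72°`. -/
theorem inner_nbr_nbr {x y w : EuclideanSpace ℝ (Fin 4)} (hx : x ∈ C) (hy : y ∈ C) (hw : w ∈ C)
    (hxy : inner ℝ x y = (1 + Real.sqrt 5) / 4) (hxw : inner ℝ x w = (1 + Real.sqrt 5) / 4) (hyw : y ≠ w) :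
    inner ℝ y w = (1 + Real.sqrt 5) / 4 ∨ inner ℝ y w = 1 / 2 ∨ inner ℝ y w = (Real.sqrt 5 - 1) / 4 := by
  obtain ⟨hX, hlo, hhi⟩ := sqrt5_facts
  -- `⟪y, w⟫ ≥ 2t² - 1 = (√5 - 1)/4`
  have hge : (Real.sqrt 5 - 1) / 4 ≤ inner ℝ y w := by
    have hnn : 0 ≤ ‖y + w - (2 * ((1 + Real.sqrt 5) / 4)) • x‖ ^ 2 := sq_nonneg _
    rw [← real_inner_self_eq_norm_sq] at hnn
    simp only [inner_add_left, inner_add_right, inner_sub_left, inner_sub_right, real_inner_smul_left,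
      real_inner_smul_right] at hnn
    have hyx : inner ℝ y x = (1 + Real.sqrt 5) / 4 := by rw [real_inner_comm]; exact hxy
    have hwx : inner ℝ w x = (1 + Real.sqrt 5) / 4 := by rw [real_inner_comm]; exact hxw
    have hwy : inner ℝ w y = inner ℝ y w := real_inner_comm y w
    simp only [real_inner_self_eq_norm_sq, h1 x hx, h1 y hy, h1 w hw, hxy, hxw, hyx, hwx, hwy] at hnn
    nlinarith [hnn, hX]
  rcases inner_mem_of_card_eq_120 h1 h2 hN hy hw hyw with h | h | h | h | h | h | h | h
  · exact Or.inl h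
  · exact Or.inr (Or.inl h)
  · exact Or.inr (Or.inr h)
  all_goals exfalso; rw [h] at hge; nlinarith [hlo, hhi]

/-- **The frame.** A `120`-point code of angle `36°` in `ℝ⁴` contains four points pairwise at inner product
`(1+√5)/4` (a tetrahedral cell of the 600-cell). -/
theorem exists_frame : ∃ a : Fin 4 → EuclideanSpace ℝ (Fin 4), (∀ i, a i ∈ C) ∧
    ∀ i j, inner ℝ (a i) (a j) = if i = j then 1 else (1 + Real.sqrt 5) / 4 := by
  classical
  obtain ⟨hX, hlo, hhi⟩ := sqrt5_facts
  set t : ℝ := (1 + Real.sqrt 5) / 4 with ht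
  have ht2 : t ^ 2 = (3 + Real.sqrt 5) / 8 := by rw [ht]; nlinarith [hX]
  have hρ2 : 0 < 1 - t ^ 2 := by rw [ht2]; nlinarith [hlo, hhi]
  set ρ : ℝ := Real.sqrt (1 - t ^ 2) with hρ
  have hρpos : 0 < ρ := Real.sqrt_pos.mpr hρ2
  have hρsq : ρ ^ 2 = 1 - t ^ 2 := Real.sq_sqrt hρ2.le
  -- a point and its twelve neighbours
  have hne : C.Nonempty := by rw [← Finset.card_pos, hN]; norm_num
  obtain ⟨x, hx⟩ := hne
  set N := (C.erase x).filter fun w => inner ℝ x w = t with hNdef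
  have hcardN : N.card = 12 := card_nbr_eq_twelve h1 h2 hN hx
  have hmemN : ∀ {w}, w ∈ N → w ∈ C ∧ w ≠ x ∧ inner ℝ x w = t := fun hw => by
    obtain ⟨hw1, hw2⟩ := mem_filter.mp hw
    exact ⟨mem_of_mem_erase hw1, ne_of_mem_erase hw1, hw2⟩
  -- the derived vectors
  set g : EuclideanSpace ℝ (Fin 4) → EuclideanSpace ℝ (Fin 4) := fun w => ρ⁻¹ • (w - t • x) with hg
  have hginner : ∀ {y w}, y ∈ N → w ∈ N → inner ℝ (g y) (g w) = (inner ℝ y w - t ^ 2) / (1 - t ^ 2) := by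
    intro y w hy hw
    obtain ⟨hyC, -, hxy⟩ := hmemN hy
    obtain ⟨hwC, -, hxw⟩ := hmemN hw
    simp only [hg, real_inner_smul_left, real_inner_smul_right, inner_sub_left, inner_sub_right,
      real_inner_self_eq_norm_sq, h1 x hx]
    have hyx : inner ℝ y x = t := by rw [real_inner_comm]; exact hxy
    rw [hyx, hxw, ← hρsq]
    field_simp
    ring
  have hgnorm : ∀ {w}, w ∈ N → ‖g w‖ = 1 := by
    intro w hw
    have h := hginner hw hw
    rw [real_inner_self_eq_norm_sq, real_inner_self_eq_norm_sq, h1 w (hmemN hw).1, one_pow,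
      div_self hρ2.ne'] at h
    nlinarith [norm_nonneg (g w)]
  -- the three possible derived inner products
  have hv1 : ((1 + Real.sqrt 5) / 4 - t ^ 2) / (1 - t ^ 2) = Real.sqrt 5 / 5 := by
    rw [div_eq_iff hρ2.ne', ht2]
    linear_combination (1 / 40) * hX
  have hv2 : (1 / 2 - t ^ 2) / (1 - t ^ 2) = -(Real.sqrt 5 / 5) := by
    rw [div_eq_iff hρ2.ne', ht2]
    linear_combination (-1 / 40) * hX
  have hv3 : ((Real.sqrt 5 - 1) / 4 - t ^ 2) / (1 - t ^ 2) = -1 := by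
    rw [div_eq_iff hρ2.ne', ht2]
    ring
  have hsq : (Real.sqrt 5 / 5) ^ 2 = 1 / 5 := by rw [div_pow, hX]; norm_num
  have hgval : ∀ {y w}, y ∈ N → w ∈ N → y ≠ w →
      inner ℝ (g y) (g w) = -1 ∨ inner ℝ (g y) (g w) ^ 2 = 1 / 5 := by
    intro y w hy hw hyw
    rw [hginner hy hw]
    rcases inner_nbr_nbr h1 h2 hN hx (hmemN hy).1 (hmemN hw).1 (hmemN hy).2.2 (hmemN hw).2.2 hyw with h | h | h
    · right; rw [h, hv1, hsq]
    · right; rw [h, hv2, neg_sq, hsq]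
    · left; rw [h, hv3]
  have hgadj : ∀ {y w}, y ∈ N → w ∈ N → inner ℝ (g y) (g w) = Real.sqrt 5 / 5 → inner ℝ y w = t := by
    intro y w hy hw h
    by_cases hyw : y = w
    · exfalso
      rw [hyw, real_inner_self_eq_norm_sq, hgnorm hw] at h
      nlinarith [hlo, hhi]
    rw [hginner hy hw] at h
    rcases inner_nbr_nbr h1 h2 hN hx (hmemN hy).1 (hmemN hw).1 (hmemN hy).2.2 (hmemN hw).2.2 hyw with h' | h' | h'
    · exact h'
    · exfalso; rw [h', hv2] at h; nlinarith [hlo]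
    · exfalso; rw [h', hv3] at h; nlinarith [hlo]
  -- transfer to `ℝ³`
  have hx0 : x ≠ 0 := by
    intro h; have := h1 x hx; rw [h, norm_zero] at this; exact zero_ne_one this
  haveI : Fact (finrank ℝ (EuclideanSpace ℝ (Fin 4)) = 3 + 1) := ⟨finrank_euclideanSpace_fin⟩
  have hV : finrank ℝ (ℝ ∙ x)ᗮ = 3 := Submodule.finrank_orthogonal_span_singleton hx0
  obtain ⟨f, hf⟩ := exists_inner_preserving (ℝ ∙ x)ᗮ hV
  have hgV : ∀ {w}, w ∈ N → g w ∈ (ℝ ∙ x)ᗮ := by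
    intro w hw
    rw [Submodule.mem_orthogonal_singleton_iff_inner_right]
    simp only [hg, real_inner_smul_right, inner_sub_right, real_inner_self_eq_norm_sq, h1 x hx, (hmemN hw).2.2]
    ring
  set D := N.image fun w => f (g w) with hD
  have hfg_inj : Set.InjOn (fun w => f (g w)) N := by
    intro y hy w hw hyw
    have h := injOn_of_inner_preserving hf (hgV hy) (hgV hw) hyw
    simp only [hg] at h
    have h' := smul_right_injective _ (inv_ne_zero hρpos.ne') h
    simpa using h'
  have hcardD : D.card = 12 := by rw [hD, card_image_of_injOn hfg_inj, hcardN]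
  have hmemD : ∀ {p}, p ∈ D → ∃ w ∈ N, p = f (g w) := fun hp => by
    obtain ⟨w, hw, rfl⟩ := mem_image.mp hp; exact ⟨w, hw, rfl⟩
  have h1D : ∀ p ∈ D, ‖p‖ = 1 := by
    intro p hp
    obtain ⟨w, hw, rfl⟩ := hmemD hp
    have h := hf _ (hgV hw) _ (hgV hw)
    rw [real_inner_self_eq_norm_sq, real_inner_self_eq_norm_sq, hgnorm hw] at h
    nlinarith [norm_nonneg (f (g w))]
  have hvD : ∀ p ∈ D, ∀ p' ∈ D, p ≠ p' → inner ℝ p p' = -1 ∨ inner ℝ p p' ^ 2 = 1 / 5 := by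
    intro p hp p' hp' hpp'
    obtain ⟨y, hy, rfl⟩ := hmemD hp
    obtain ⟨w, hw, rfl⟩ := hmemD hp'
    have hyw : y ≠ w := fun h => hpp' (by rw [h])
    rw [hf _ (hgV hy) _ (hgV hw)]
    exact hgval hy hw hyw
  -- a vertex `y` of the icosahedron, a neighbour `z`, and a common neighbour `w`
  have hNne : N.Nonempty := by rw [← Finset.card_pos, hcardN]; norm_num
  obtain ⟨y, hy⟩ := hNne
  have hyD : f (g y) ∈ D := mem_image_of_mem _ hy
  have h5 := IcosahedronNbr.card_nbr h1D hcardD hvD hyD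
  have hne5 : (D.filter fun p => inner ℝ (f (g y)) p = Real.sqrt 5 / 5).Nonempty := by
    rw [← Finset.card_pos, h5]; norm_num
  obtain ⟨pz, hpz⟩ := hne5
  obtain ⟨hpzD, hyz'⟩ := mem_filter.mp hpz
  obtain ⟨z, hz, rfl⟩ := hmemD hpzD
  have hyz : inner ℝ y z = t := hgadj hy hz (by rwa [hf _ (hgV hy) _ (hgV hz)] at hyz')
  have h2' := IcosahedronNbr.card_filter_eq_two h1D hcardD hvD hyD hpzD hyz'
  have hne2 : ((D.filter fun p => inner ℝ (f (g y)) p = Real.sqrt 5 / 5).filter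
      fun p => p ≠ f (g z) ∧ inner ℝ (f (g z)) p = Real.sqrt 5 / 5).Nonempty := by
    rw [← Finset.card_pos, h2']; norm_num
  obtain ⟨pw, hpw⟩ := hne2
  obtain ⟨hpw1, -, hzw'⟩ := mem_filter.mp hpw
  obtain ⟨hpwD, hyw'⟩ := mem_filter.mp hpw1
  obtain ⟨w, hw, rfl⟩ := hmemD hpwD
  have hyw : inner ℝ y w = t := hgadj hy hw (by rwa [hf _ (hgV hy) _ (hgV hw)] at hyw')
  have hzw : inner ℝ z w = t := hgadj hz hw (by rwa [hf _ (hgV hz) _ (hgV hw)] at hzw')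
  -- the frame
  obtain ⟨hyC, -, hxy⟩ := hmemN hy
  obtain ⟨hzC, -, hxz⟩ := hmemN hz
  obtain ⟨hwC, -, hxw⟩ := hmemN hw
  refine ⟨![x, y, z, w], ?_, ?_⟩
  · intro i
    fin_cases i <;> simp [hx, hyC, hzC, hwC]
  · intro i j
    fin_cases i <;> fin_cases j <;>
      simp [h1 x hx, h1 y hyC, h1 z hzC, h1 w hwC, hxy, hxz, hxw, hyz, hyw, hzw,
        real_inner_comm x y, real_inner_comm x z, real_inner_comm x w, real_inner_comm y z, real_inner_comm y w,
        real_inner_comm z w, ht]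

end config

end Summit.Ventures.PackingBounds.Config.SixHundredCellCode

end
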